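import Summits.QuantumFields.YangMills.Theorems.FluctuationComparisonRegPrIntLS2BetaAbelianSymmetricCriticality
import Summits.QuantumFields.YangMills.Theorems.UnitScaleTiltProp7SymCentreAbelianFibre
import Summits.QuantumFields.YangMills.Theorems.AlphaInputsT3ACv3LinearLiftMatrix
import Summits.QuantumFields.YangMills.Theorems.UnitScaleTiltProp8EulerLagrangeCarrier
import HarnessLib

/-!
# S2β · THE ABELIAN EULER–LAGRANGE SUPPLIER: a σ₃-diagonal configuration minimising the Wilson action AMONG THE σ₃-DIAGONAL MEMBERS of print's regular fibre (6)
# is E–L-critical along EVERY fibre curve (symmetric criticality ∘ the abelian (0.4) calculus)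

Cell `ym3-torus` (YM ladder rung R3 = continuum `SU(2)` Yang–Mills on the three-torus at fixed lattice data — a RUNG: NOT d = 4, NOT infinite volume,
NOT a mass gap, NOT Clay).  Width seat `ym3-torus-px12` (gen 21), pen (B) «ABELIAN STRATUM» FILE 2; crux `stmt-QuantumFields-20520`
(`…Theses.UnitScaleTilt.FluctuationComparisonRegPrIntL`), LINE S2β; `--kind proof --supports stmt-QuantumFields-20520 --as helper`: count-neutral, DEFINITION-FREE
(0 `def`, 0 `instance`, 0 `notation`, 0 `sorry`, default heartbeats).

WHY.  ✓FILE 1 (`…S2BetaAbelianSymmetricCriticality`) reduced curve-criticality at a σ₃-diagonal configuration `U` to the ABELIAN tangent condition «`d∕dt A(U·e^{tX})|₀ = 0`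
for every σ₃-DIAGONAL kernel direction `X` of the linearised averaging».  On the diagonal torus the (0.4) averaging of record is EXPLICIT and AFFINE in the angle
one-form (✓`Prop7SymCentreAbelianFibre.descendTo_gexpAt_eq_fieldShift_of_loopSum_lt`, ✓`AbelianEML.linAvgIter`): a diagonal direction `X_b = s_b·iσ₃` moves `U = e^{a·iσ₃}`
along the abelian line `e^{(a + t s)·iσ₃}`, whose `k`-fold average is `e^{(linAvgIter k a + t·linAvgIter k s)·iσ₃}` while the loop-sum guards hold; so a diagonal KERNEL
direction has `linAvgIter k s = 0` and its line STAYS IN THE FIBRE, inside the open regular space (6) for small `t` — where an abelian constrained minimiser cannot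
decrease the action: Fermat gives the abelian tangent condition.

WHAT (`F : T3Family`, `n ≤ K`, `k = K − n ≤ m + K_P`).
* §1 `exists_coe_eq_smul_of_commute_sigma3` — a σ₃-diagonal element of `𝔰𝔲(2)` is `s·iσ₃`, `s` real; `expChart_gexpAt_eq` — `e^{a·iσ₃}·e^{tX} = e^{(a + t s)·iσ₃}`.
* §2 ★★`abelianTangentCritical_of_abelianMin` — for a lettering `a` with STRICT loop-sum guards `3|Σ(linAvgIter s′ a)| < 1` at every level `s′ < K − n`,
  `U := e^{a·iσ₃} ∈ regFibrePr F n K e V` with `t₀`-small iterated averages, minimising `A` among the σ₃-diagonal members of `regFibrePr F n K e V`: the abelian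
  tangent condition of FILE 1 holds at `U`.
* §3 ★★★`el_of_abelianMin` — hence (FILE 1 §4 + ✓`fieldShift` injectivity) `U` is E–L-critical along EVERY bond-wise differentiable fibre curve: the `hEL` binder of
  ✓`orbitGrowth_of_regular_five`, VERBATIM.

HONEST.  The abelian constrained minimiser (lettering, guards, regularity, minimality among diagonal competitors: EX^{ab}) is a HYPOTHESIS; nothing of Bałaban's
analysis is asserted; Prop. 7 cl. 1 at abelian data (FILE 3), (E), ISOL∘, TUBE-REG∘, GAP♯∘, EXW∘, S2β and crux 20520 are NOT proved; rung R3 = `YM3TorusSU2` as filed —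
SU(2) YM₃ on T³; the Yang–Mills mass gap is NOT proved.  Sorry-free, axioms standard.
[cite: Balaban1985Variational, (2)-(6) p.278, (82)-(83) p.290, (111) p.294, Prop. 7 p.299; Balaban1987RG1, (0.4) and (0.11) p.253; Balaban1985Averaging, (11) p.19]
-/

set_option autoImplicit false

noncomputable section

open scoped Matrix.Norms.L2Operator Topology
open Filter Function NormedSpace
open Literature.MathematicalPhysics.QuantumFieldTheory.Balaban1983to89
open Literature.MathematicalPhysics.QuantumFieldTheory.Balaban1983to89.T4Continuum
open Literature.MathematicalPhysics.QuantumFieldTheory.Balaban1983to89.BlockAveraging (blockAvg Idx)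
open Literature.MathematicalPhysics.QuantumFieldTheory.Balaban1983to89.ExpMeanLog (expMeanLogSU deltaSU)
open Literature.MathematicalPhysics.QuantumFieldTheory.Balaban1983to89.T4AdjointCovarianceUnitary (lieSU mem_lieSU_iff)
open Literature.MathematicalPhysics.QuantumFieldTheory.Balaban1983to89.B9AdOrthogonal (σ₃)
open Literature.MathematicalPhysics.QuantumFieldTheory.Balaban1983to89.Node00
open Literature.MathematicalPhysics.QuantumFieldTheory.Balaban1983to89.T3ContinuumYM3Torus
open Literature.MathematicalPhysics.QuantumFieldTheory.Balaban1983to89.T3UnitLawDensityEML (ℰp)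
open Literature.MathematicalPhysics.QuantumFieldTheory.Balaban1983to89.T3TiltDescent (descendTo)
open Literature.MathematicalPhysics.QuantumFieldTheory.Balaban1983to89.T3ConstrainedMinimiser (fibre)
open Literature.MathematicalPhysics.QuantumFieldTheory.Balaban1983to89.T3PrintedRegularMinimiser
open Literature.MathematicalPhysics.QuantumFieldTheory.Balaban1983to89.T3LevelShift (fieldShift fieldShift_fieldShift_symm)
open Summit.QuantumFields.Balaban3D.Carriers (suGroupModel)
open Summit.QuantumFields.YangMills.Theorems.BlockAvgCorrector (stokesConst)
open Summit.QuantumFields.YangMills.Theorems.BalabanUVNodesN08AlphaAbelianLift (gexp gexp_add)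
open Summit.QuantumFields.YangMills.Theorems.AbelianEML (gexpAt linAvgIter loopSum coe_gexp_su linAvgIter_add real_smul_ofReal_smul wsum_add wsum_smul)
open Summit.QuantumFields.YangMills.Theorems.LinearLiftMatrix (linAvgIter_smul)
open Summit.QuantumFields.YangMills.Theorems.Prop7SymCentreAbelianDict (I_smul_sigma3_mem_lie)
open Summit.QuantumFields.YangMills.Theorems.Prop7SymCentreAbelianFibre
  (descendTo_gexpAt_eq_fieldShift_of_loopSum_lt iter_blockAvg_gexpAt_of_loopSum_lt I_smul_sigma3_eq_diagonal I_smul_sigma3_ne_zero norm_I_smul_sigma3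
    commute_coe_gexpAt_sigma3)
open Summit.QuantumFields.YangMills.Theorems.Prop7NestedMeanParallelLiftDiagGauge (sigma3_eq apply01_eq_zero_of_commute_sigma3 apply10_eq_zero_of_commute_sigma3)
open Summit.QuantumFields.YangMills.Theorems.Prop8Criticality (exists_ball_subset_regPr)
open Summit.QuantumFields.YangMills.Theorems.AvgActionDefect (deltaSU_fin_two)
open Summit.QuantumFields.YangMills.Theorems.FluctuationComparisonRegPrIntLS2BetaAbelianSymmetricCriticality (curveCritical_of_abelianTangentCritical)

namespace Summit.QuantumFields.YangMills.Theorems.FluctuationComparisonRegPrIntLS2BetaAbelianCriticalOfMin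

/-! ## §1 Diagonal directions of `𝔰𝔲(2)` and the abelian line -/

section Diagonal

/-- **A σ₃-DIAGONAL ELEMENT OF `𝔰𝔲(2)` IS A REAL MULTIPLE OF `iσ₃`** (off-diagonal entries vanish; skew-Hermitian ⇒ imaginary diagonal; traceless ⇒ opposite entries).
[folklore] -/
theorem exists_coe_eq_smul_of_commute_sigma3 (X : lieSU (Fin 2)) (hX : Commute ((X : lieSU (Fin 2)) : Matrix (Fin 2) (Fin 2) ℂ) σ₃) :
    ∃ s : ℝ, ((X : lieSU (Fin 2)) : Matrix (Fin 2) (Fin 2) ℂ) = ((s : ℝ) : ℂ) • (Complex.I • σ₃ : Matrix (Fin 2) (Fin 2) ℂ) := by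
  obtain ⟨hskew, htr⟩ := mem_lieSU_iff.mp X.2
  have h01 := apply01_eq_zero_of_commute_sigma3 hX
  have h10 := apply10_eq_zero_of_commute_sigma3 hX
  set M : Matrix (Fin 2) (Fin 2) ℂ := ((X : lieSU (Fin 2)) : Matrix (Fin 2) (Fin 2) ℂ) with hM
  -- skew-Hermitian diagonal entry: `conj (M 0 0) = − M 0 0`
  have h00 : (starRingEnd ℂ) (M 0 0) = -M 0 0 := by
    have h := congrFun (congrFun hskew 0) 0
    rw [Matrix.star_apply, Matrix.neg_apply] at h
    exact h
  -- traceless: `M 1 1 = − M 0 0`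
  have h11 : M 1 1 = -M 0 0 := by
    rw [Matrix.trace_fin_two] at htr
    linear_combination htr
  have hre : (M 0 0).re = 0 := by
    have h := congrArg Complex.re h00
    rw [Complex.conj_re, Complex.neg_re] at h
    linarith
  obtain ⟨r, hr⟩ : ∃ r : ℝ, M 0 0 = ((r : ℝ) : ℂ) * Complex.I :=
    ⟨(M 0 0).im, by apply Complex.ext <;> simp [hre]⟩
  refine ⟨r, ?_⟩
  rw [I_smul_sigma3_eq_diagonal]
  ext i j
  fin_cases i <;> fin_cases j
  · simp [hr]
  · simpa using h01
  · simpa using h10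
  · simp [h11, hr]

end Diagonal

section Line

variable {P : Params}

/-- **THE ABELIAN LINE**: at the diagonal configuration `e^{a·iσ₃}`, a diagonal direction `X_b = s_b·iσ₃` exponentiates to `e^{(a + t s)·iσ₃}`. [cite: Balaban1985Averaging, (3) p.18 and (22) p.21] -/
theorem expChart_gexpAt_eq (a s : PBond P 0 → ℝ) (X : PBond P 0 → lieSU (Fin 2))
    (hs : ∀ b, ((X b : lieSU (Fin 2)) : Matrix (Fin 2) (Fin 2) ℂ) = ((s b : ℝ) : ℂ) • (Complex.I • σ₃ : Matrix (Fin 2) (Fin 2) ℂ)) (t : ℝ) :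
    expChart (gexpAt (suGroupModel 2) I_smul_sigma3_mem_lie a) (t • X) = gexpAt (suGroupModel 2) I_smul_sigma3_mem_lie (a + t • s) := by
  funext b
  apply Subtype.ext
  rw [coe_expChart]
  show ((gexp (suGroupModel 2) I_smul_sigma3_mem_lie (a b) : Matrix.specialUnitaryGroup (Fin 2) ℂ) : Matrix (Fin 2) (Fin 2) ℂ) *
      NormedSpace.exp (((t • X) b : lieSU (Fin 2)) : Matrix (Fin 2) (Fin 2) ℂ) =
    ((gexp (suGroupModel 2) I_smul_sigma3_mem_lie ((a + t • s) b) : Matrix.specialUnitaryGroup (Fin 2) ℂ) : Matrix (Fin 2) (Fin 2) ℂ)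
  rw [Pi.smul_apply, Submodule.coe_smul, hs b, real_smul_ofReal_smul, ← coe_gexp_su I_smul_sigma3_mem_lie (t * s b), ← Submonoid.coe_mul, gexp_add]
  simp only [Pi.add_apply, Pi.smul_apply, smul_eq_mul]

end Line

/-! ## §2 The abelian tangent condition from an abelian constrained minimiser -/

section Supplier

variable (F : T3Family) {n K : ℕ}

/-- Linearity of the iterated (0.4)-linear average along an affine line of one-forms. [cite: Balaban1987RG1, (0.4)+(0.11) p.253] -/
theorem linAvgIter_add_smul {P : Params} (k : ℕ) (a s : PBond P 0 → ℝ) (t : ℝ) :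
    linAvgIter k (a + t • s) = linAvgIter k a + t • linAvgIter k s := by
  rw [linAvgIter_add, linAvgIter_smul]

/-- Linearity of a loop sum along an affine line of one-forms. [cite: Balaban1987RG1, (0.4) p.253] -/
theorem loopSum_add_smul {P : Params} {j : ℕ} (a s : PBond P j → ℝ) (t : ℝ) (c : PBond P (j + 1)) (i : Idx P) :
    loopSum (a + t • s) c i = loopSum a c i + t * loopSum s c i := by
  have hsm : t • s = fun b => t * s b := by funext b; simp
  unfold loopSum
  rw [wsum_add, hsm, wsum_smul]

/-- ★★ **THE ABELIAN TANGENT CONDITION FROM AN ABELIAN CONSTRAINED MINIMISER.**  Let `U := e^{a·iσ₃}` for a lettering `a` with strict loop-sum guards at every level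
`s′ < K − n`, `U ∈ regFibrePr F n K e V`, minimising the Wilson action among the σ₃-DIAGONAL members of
`regFibrePr F n K e V`.  Then `d∕dt A(U·e^{tX})|₀ = 0` for every σ₃-diagonal kernel direction `X` of the linearised `(K − n)`-fold averaging (FILE 1's `habel`):
such an `X` is `s·iσ₃` with `linAvgIter (K−n) s = 0` (the explicit abelian average has derivative `e^{θ·iσ₃}·(linAvgIter s)·iσ₃`), so the abelian line `e^{(a+ts)·iσ₃}`
stays in the fibre and, for small `t`, in the open space (6) (✓`exists_ball_subset_regPr`) — Fermat. [cite: Balaban1985Variational, (2)-(6) p.278, (111) p.294; Balaban1987RG1, (0.4)+(0.11) p.253] -/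
theorem abelianTangentCritical_of_abelianMin (h : n ≤ K) {e : ℝ}
    {V : GaugeField (F.P n) 0 (Matrix.specialUnitaryGroup (Fin 2) ℂ)} (a : PBond (F.P K) 0 → ℝ)
    (hloop : ∀ s', s' < K - n → ∀ (c : PBond (F.P K) (s' + 1)) (i : Idx (F.P K)), 3 * |loopSum (linAvgIter s' a) c i| < 1)
    (hreg : gexpAt (suGroupModel 2) I_smul_sigma3_mem_lie a ∈ regFibrePr F n K h e V)
    (hmin : ∀ W' : GaugeField (F.P K) 0 (Matrix.specialUnitaryGroup (Fin 2) ℂ),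
      (∀ b, Commute ((W' b : Matrix.specialUnitaryGroup (Fin 2) ℂ) : Matrix (Fin 2) (Fin 2) ℂ) σ₃) → W' ∈ regFibrePr F n K h e V →
        wilsonAction4 (gexpAt (suGroupModel 2) I_smul_sigma3_mem_lie a) ≤ wilsonAction4 W') :
    ∀ X : PBond (F.P K) 0 → lieSU (Fin 2), (∀ b, Commute ((X b : lieSU (Fin 2)) : Matrix (Fin 2) (Fin 2) ℂ) σ₃) →
      (∀ c : PBond (F.P K) (K - n), HasDerivAt (fun t : ℝ => ((Averaging.iter (fun i => blockAvg (P := F.P K) (j := i) (expMeanLogSU (n := Fin 2))) (K - n)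
        (expChart (gexpAt (suGroupModel 2) I_smul_sigma3_mem_lie a) (t • X)) c : Matrix.specialUnitaryGroup (Fin 2) ℂ) : Matrix (Fin 2) (Fin 2) ℂ)) 0 0) →
      HasDerivAt (fun t : ℝ => wilsonAction4 (expChart (gexpAt (suGroupModel 2) I_smul_sigma3_mem_lie a) (t • X))) 0 0 := by
  intro X hXdiag hXker
  set U : GaugeField (F.P K) 0 (Matrix.specialUnitaryGroup (Fin 2) ℂ) := gexpAt (suGroupModel 2) I_smul_sigma3_mem_lie a with hU
  -- the direction in angle letters
  choose s hs using fun b => exists_coe_eq_smul_of_commute_sigma3 (X b) (hXdiag b)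
  have hray : ∀ t : ℝ, expChart U (t • X) = gexpAt (suGroupModel 2) I_smul_sigma3_mem_lie (a + t • s) := expChart_gexpAt_eq a s X hs
  -- the loop-sum guards persist along the line for small `t`
  have hguard : ∀ᶠ t in 𝓝 (0 : ℝ), ∀ s', s' < K - n → ∀ (c : PBond (F.P K) (s' + 1)) (i : Idx (F.P K)),
      |loopSum (linAvgIter s' (a + t • s)) c i| * ‖(Complex.I • σ₃ : Matrix (Fin 2) (Fin 2) ℂ)‖ < min (deltaSU (Fin 2)) (Real.log 2) := by
    have hmin3 : (1 : ℝ) / 3 ≤ min (deltaSU (Fin 2)) (Real.log 2) := by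
      rw [deltaSU_fin_two]
      refine le_min le_rfl ?_
      have := Real.log_two_gt_d9; norm_num at this ⊢; linarith
    have hone : ∀ s', s' < K - n → ∀ (c : PBond (F.P K) (s' + 1)) (i : Idx (F.P K)),
        ∀ᶠ t in 𝓝 (0 : ℝ), 3 * |loopSum (linAvgIter s' a) c i + t * loopSum (linAvgIter s' s) c i| < 1 := by
      intro s' hs' c i
      have hc : Continuous fun t : ℝ => 3 * |loopSum (linAvgIter s' a) c i + t * loopSum (linAvgIter s' s) c i| := by fun_prop
      have h0 : 3 * |loopSum (linAvgIter s' a) c i + 0 * loopSum (linAvgIter s' s) c i| < 1 := by simpa using hloop s' hs' c i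
      exact hc.continuousAt.eventually_lt continuousAt_const (by simpa using h0)
    have hall : ∀ᶠ t in 𝓝 (0 : ℝ), ∀ s' : Fin (K - n), ∀ (c : PBond (F.P K) (s'.1 + 1)) (i : Idx (F.P K)),
        3 * |loopSum (linAvgIter s'.1 a) c i + t * loopSum (linAvgIter s'.1 s) c i| < 1 :=
      eventually_all.2 fun s' => eventually_all.2 fun c => eventually_all.2 fun i => hone s'.1 s'.2 c i
    refine hall.mono fun t ht s' hs' c i => ?_
    rw [linAvgIter_add_smul, loopSum_add_smul, norm_I_smul_sigma3, mul_one]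
    have h3 := ht ⟨s', hs'⟩ c i
    have : |loopSum (linAvgIter s' a) c i + t * loopSum (linAvgIter s' s) c i| < 1 / 3 := by linarith
    exact this.trans_le hmin3
  -- along the line the iterated average is EXPLICIT
  have hiter : ∀ᶠ t in 𝓝 (0 : ℝ), Averaging.iter (fun i => blockAvg (P := F.P K) (j := i) (expMeanLogSU (n := Fin 2))) (K - n) (expChart U (t • X)) =
      gexpAt (suGroupModel 2) I_smul_sigma3_mem_lie (linAvgIter (K - n) a + t • linAvgIter (K - n) s) := by
    refine hguard.mono fun t ht => ?_
    rw [hray t, iter_blockAvg_gexpAt_of_loopSum_lt (P := F.P K) I_smul_sigma3_mem_lie (K - n) (a + t • s) ht, linAvgIter_add_smul]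
  -- the kernel condition forces `linAvgIter (K − n) s = 0`
  have hB : linAvgIter (K - n) s = 0 := by
    funext c
    set θ : ℝ := linAvgIter (K - n) a c with hθ
    set B : ℝ := linAvgIter (K - n) s c with hB'
    -- the explicit bond matrix along the line and its derivative at `0`
    have hfun : ∀ᶠ t in 𝓝 (0 : ℝ), ((Averaging.iter (fun i => blockAvg (P := F.P K) (j := i) (expMeanLogSU (n := Fin 2))) (K - n)
        (expChart U (t • X)) c : Matrix.specialUnitaryGroup (Fin 2) ℂ) : Matrix (Fin 2) (Fin 2) ℂ) =
        ((gexp (suGroupModel 2) I_smul_sigma3_mem_lie θ : Matrix.specialUnitaryGroup (Fin 2) ℂ) : Matrix (Fin 2) (Fin 2) ℂ) *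
          NormedSpace.exp (t • (((B : ℝ) : ℂ) • (Complex.I • σ₃ : Matrix (Fin 2) (Fin 2) ℂ))) := by
      refine hiter.mono fun t ht => ?_
      rw [ht]
      show ((gexp (suGroupModel 2) I_smul_sigma3_mem_lie ((linAvgIter (K - n) a + t • linAvgIter (K - n) s) c) : Matrix.specialUnitaryGroup (Fin 2) ℂ) :
          Matrix (Fin 2) (Fin 2) ℂ) = _
      rw [Pi.add_apply, Pi.smul_apply, smul_eq_mul, ← gexp_add, Submonoid.coe_mul, coe_gexp_su I_smul_sigma3_mem_lie (t * B), ← real_smul_ofReal_smul]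
    have hexp : HasDerivAt (fun t : ℝ => ((gexp (suGroupModel 2) I_smul_sigma3_mem_lie θ : Matrix.specialUnitaryGroup (Fin 2) ℂ) : Matrix (Fin 2) (Fin 2) ℂ) *
        NormedSpace.exp (t • (((B : ℝ) : ℂ) • (Complex.I • σ₃ : Matrix (Fin 2) (Fin 2) ℂ))))
        (((gexp (suGroupModel 2) I_smul_sigma3_mem_lie θ : Matrix.specialUnitaryGroup (Fin 2) ℂ) : Matrix (Fin 2) (Fin 2) ℂ) *
          (NormedSpace.exp ((0 : ℝ) • (((B : ℝ) : ℂ) • (Complex.I • σ₃ : Matrix (Fin 2) (Fin 2) ℂ))) * (((B : ℝ) : ℂ) • (Complex.I • σ₃ : Matrix (Fin 2) (Fin 2) ℂ)))) 0 :=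
      (hasDerivAt_exp_smul_const (𝕂 := ℝ) (((B : ℝ) : ℂ) • (Complex.I • σ₃ : Matrix (Fin 2) (Fin 2) ℂ)) 0).const_mul _
    rw [zero_smul, NormedSpace.exp_zero, one_mul] at hexp
    have hder : HasDerivAt (fun t : ℝ => ((Averaging.iter (fun i => blockAvg (P := F.P K) (j := i) (expMeanLogSU (n := Fin 2))) (K - n)
        (expChart U (t • X)) c : Matrix.specialUnitaryGroup (Fin 2) ℂ) : Matrix (Fin 2) (Fin 2) ℂ))
        (((gexp (suGroupModel 2) I_smul_sigma3_mem_lie θ : Matrix.specialUnitaryGroup (Fin 2) ℂ) : Matrix (Fin 2) (Fin 2) ℂ) *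
          (((B : ℝ) : ℂ) • (Complex.I • σ₃ : Matrix (Fin 2) (Fin 2) ℂ))) 0 :=
      hexp.congr_of_eventuallyEq hfun
    have hzero := (hXker c).unique hder
    -- cancel the invertible factor `e^{θ·iσ₃}`
    have hunit : star ((gexp (suGroupModel 2) I_smul_sigma3_mem_lie θ : Matrix.specialUnitaryGroup (Fin 2) ℂ) : Matrix (Fin 2) (Fin 2) ℂ) *
        ((gexp (suGroupModel 2) I_smul_sigma3_mem_lie θ : Matrix.specialUnitaryGroup (Fin 2) ℂ) : Matrix (Fin 2) (Fin 2) ℂ) = 1 :=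
      (gexp (suGroupModel 2) I_smul_sigma3_mem_lie θ).2.1.1
    have hsmul : (((B : ℝ) : ℂ) • (Complex.I • σ₃ : Matrix (Fin 2) (Fin 2) ℂ)) = 0 := by
      have h := congrArg (fun M => star ((gexp (suGroupModel 2) I_smul_sigma3_mem_lie θ : Matrix.specialUnitaryGroup (Fin 2) ℂ) : Matrix (Fin 2) (Fin 2) ℂ) * M) hzero
      rw [mul_zero, ← mul_assoc, hunit, one_mul] at h
      exact h.symm
    have hBz : ((B : ℝ) : ℂ) = 0 := by
      rcases smul_eq_zero.mp hsmul with hB0 | hY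
      · exact hB0
      · exact absurd hY I_smul_sigma3_ne_zero
    exact_mod_cast hBz
  -- so the line stays in the fibre …
  have hV : V = descendTo F ℰp n K h U := ((mem_regFibrePr_iff F).mp hreg).1.symm
  have hfib : ∀ᶠ t in 𝓝 (0 : ℝ), expChart U (t • X) ∈ fibre F ℰp n K h V := by
    refine hiter.mono fun t ht => ?_
    have h0 : Averaging.iter (fun i => blockAvg (P := F.P K) (j := i) (expMeanLogSU (n := Fin 2))) (K - n) U =
        gexpAt (suGroupModel 2) I_smul_sigma3_mem_lie (linAvgIter (K - n) a) := by
      have h00 := hiter.self_of_nhds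
      rw [zero_smul, expChart_zero, zero_smul, add_zero] at h00
      exact h00
    show descendTo F ℰp n K h (expChart U (t • X)) = V
    rw [hV]
    unfold descendTo
    rw [ht, hB, smul_zero, add_zero, ← h0]
  -- … and in the open regular space (6)
  have hregU : RegPr F n K e U := ((mem_regFibrePr_iff F).mp hreg).2
  obtain ⟨δ, hδ, hball⟩ := exists_ball_subset_regPr F n K e U hregU
  have hcont : ∀ b : PBond (F.P K) 0, ∀ᶠ t in 𝓝 (0 : ℝ),
      ‖((expChart U (t • X) b : Matrix.specialUnitaryGroup (Fin 2) ℂ) : Matrix (Fin 2) (Fin 2) ℂ) - ((U b : Matrix.specialUnitaryGroup (Fin 2) ℂ) : Matrix (Fin 2) (Fin 2) ℂ)‖ < δ := by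
    intro b
    have hc : ContinuousAt (fun t : ℝ => ((expChart U (t • X) b : Matrix.specialUnitaryGroup (Fin 2) ℂ) : Matrix (Fin 2) (Fin 2) ℂ)) 0 :=
      (hasDerivAt_coe_expChart_along (U := U) (c := fun t : ℝ => t • X) (hasDerivAt_ray X) (zero_smul ℝ X) b).continuousAt
    have h0 : ‖((expChart U ((0 : ℝ) • X) b : Matrix.specialUnitaryGroup (Fin 2) ℂ) : Matrix (Fin 2) (Fin 2) ℂ) -
        ((U b : Matrix.specialUnitaryGroup (Fin 2) ℂ) : Matrix (Fin 2) (Fin 2) ℂ)‖ < δ := by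
      rw [zero_smul, expChart_zero, sub_self, norm_zero]; exact hδ
    exact ((hc.sub continuousAt_const).norm).eventually_lt continuousAt_const h0
  have hregT : ∀ᶠ t in 𝓝 (0 : ℝ), RegPr F n K e (expChart U (t • X)) :=
    (eventually_all.2 hcont).mono fun t ht => hball _ ht
  -- the line is diagonal, so the minimiser property gives a local minimum of the action along it
  have hlocmin : IsLocalMin (fun t : ℝ => wilsonAction4 (expChart U (t • X))) 0 := by
    refine (hfib.and hregT).mono fun t ht => ?_
    show wilsonAction4 (expChart U ((0 : ℝ) • X)) ≤ wilsonAction4 (expChart U (t • X))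
    rw [zero_smul, expChart_zero]
    refine hmin _ (fun b => ?_) ((mem_regFibrePr_iff F).mpr ⟨ht.1, ht.2⟩)
    rw [hray t]
    exact commute_coe_gexpAt_sigma3 _ b
  -- Fermat
  obtain ⟨a', ha'⟩ : ∃ a' : ℝ, HasDerivAt (fun t : ℝ => wilsonAction4 (expChart U (t • X))) a' 0 :=
    ⟨_, hasDerivAt_wilsonAction4 (fun b => hasDerivAt_coe_expChart_along (U := U) (c := fun t : ℝ => t • X) (hasDerivAt_ray X) (zero_smul ℝ X) b)
      fun p => hasDerivAt_coe_plaqHol (fun b => hasDerivAt_coe_expChart_along (U := U) (c := fun t : ℝ => t • X) (hasDerivAt_ray X) (zero_smul ℝ X) b) p⟩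
  have ha0 : a' = 0 := hlocmin.hasDerivAt_eq_zero ha'
  rw [ha0] at ha'
  exact ha'

/-! ## §3 The `hEL` edition: E–L along every fibre curve -/

/-- ★★★ **AN ABELIAN CONSTRAINED MINIMISER IS EULER–LAGRANGE-CRITICAL ALONG EVERY FIBRE CURVE** — the `hEL` binder of ✓`orbitGrowth_of_regular_five`, VERBATIM, at
`W := e^{a·iσ₃}`: for a lettering `a` with strict loop-sum guards below `K − n`, `t₀`-small iterated averages of `W` (`stokesConst·t₀ < δ₂`, `K − n ≤ m + K_P`),
`W ∈ regFibrePr F n K e V` minimising the Wilson action among the σ₃-DIAGONAL members of `regFibrePr F n K e V`: along every bond-wise differentiable curve `γ` in the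
fibre of `V` through `W`, `(A ∘ γ)′(0) = 0`.  Proof: §2 ∘ ✓FILE 1 `curveCritical_of_abelianTangentCritical` (Palais for `iσ₃`), the fibre condition read through the
injective level identification `fieldShift`. [cite: Balaban1985Variational, (3)-(6) p.278, (82)-(83) p.290, (111) p.294, Prop. 7 p.299; Balaban1987RG1, (0.4)+(0.11) p.253] -/
theorem el_of_abelianMin (h : n ≤ K) (hk : K - n ≤ (F.P K).m + (F.P K).K) {e t₀ : ℝ} (ht₀ : 0 < t₀) (hstδ : stokesConst (F.P K) * t₀ < deltaSU (Fin 2))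
    {V : GaugeField (F.P n) 0 (Matrix.specialUnitaryGroup (Fin 2) ℂ)} (a : PBond (F.P K) 0 → ℝ)
    (hloop : ∀ s', s' < K - n → ∀ (c : PBond (F.P K) (s' + 1)) (i : Idx (F.P K)), 3 * |loopSum (linAvgIter s' a) c i| < 1)
    (hsm : ∀ i, i < K - n → PlaqSmall t₀ (Averaging.iter (fun i => blockAvg (P := F.P K) (j := i) (expMeanLogSU (n := Fin 2))) i
      (gexpAt (suGroupModel 2) I_smul_sigma3_mem_lie a)))
    (hreg : gexpAt (suGroupModel 2) I_smul_sigma3_mem_lie a ∈ regFibrePr F n K h e V)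
    (hmin : ∀ W' : GaugeField (F.P K) 0 (Matrix.specialUnitaryGroup (Fin 2) ℂ),
      (∀ b, Commute ((W' b : Matrix.specialUnitaryGroup (Fin 2) ℂ) : Matrix (Fin 2) (Fin 2) ℂ) σ₃) → W' ∈ regFibrePr F n K h e V →
        wilsonAction4 (gexpAt (suGroupModel 2) I_smul_sigma3_mem_lie a) ≤ wilsonAction4 W') :
    ∀ γ : ℝ → GaugeField (F.P K) 0 (Matrix.specialUnitaryGroup (Fin 2) ℂ), γ 0 = gexpAt (suGroupModel 2) I_smul_sigma3_mem_lie a →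
      (∀ t, γ t ∈ fibre F ℰp n K h V) →
      (∀ b, DifferentiableAt ℝ (fun t => ((γ t b : Matrix.specialUnitaryGroup (Fin 2) ℂ) : Matrix (Fin 2) (Fin 2) ℂ)) 0) →
        deriv (fun t => wilsonAction4 (γ t)) 0 = 0 := by
  intro γ hγ0 hγfib hγd
  by_cases hdiff : DifferentiableAt ℝ (fun t => wilsonAction4 (γ t)) 0
  · have ha := hdiff.hasDerivAt
    have hfib : ∀ᶠ t in 𝓝 (0 : ℝ), Averaging.iter (fun i => blockAvg (P := F.P K) (j := i) (expMeanLogSU (n := Fin 2))) (K - n) (γ t) =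
        Averaging.iter (fun i => blockAvg (P := F.P K) (j := i) (expMeanLogSU (n := Fin 2))) (K - n) (gexpAt (suGroupModel 2) I_smul_sigma3_mem_lie a) := by
      refine Filter.Eventually.of_forall fun t => ?_
      have h1 : descendTo F ℰp n K h (γ t) = descendTo F ℰp n K h (γ 0) := by
        have ht : descendTo F ℰp n K h (γ t) = V := hγfib t
        have h0 : descendTo F ℰp n K h (γ 0) = V := hγfib 0
        rw [ht, h0]
      rw [hγ0] at h1
      unfold descendTo at h1
      have h2 := congrArg (fieldShift (G := Matrix.specialUnitaryGroup (Fin 2) ℂ)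
        (F.sitesPerDir_eq (m := F.m) (K := n) (j := 0) (m' := F.m) (K' := K) (j' := K - n) (by omega)).symm) h1
      rw [fieldShift_fieldShift_symm, fieldShift_fieldShift_symm] at h2
      exact h2
    exact curveCritical_of_abelianTangentCritical hk ht₀ hstδ hsm (fun b => commute_coe_gexpAt_sigma3 _ b)
      (abelianTangentCritical_of_abelianMin F h a hloop hreg hmin) γ hγ0 (differentiableAt_pi.2 hγd) hfib ha
  · exact deriv_zero_of_not_differentiableAt hdiff

end Supplier

end Summit.QuantumFields.YangMills.Theorems.FluctuationComparisonRegPrIntLS2BetaAbelianCriticalOfMin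

end
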